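import Summits.BirchSwinnertonDyer.BirchSwinnertonDyer.Theorems.ByReductionTypeAtTwoAdditiveKatoTransport
import Literature.NumberTheory.EllipticCurves.Kato2004.DivisibilityInputsContraExceptionalTransportProofs
import HarnessLib

/-!
# Route ByReductionTypeAtTwo, crux `AdditiveRankZeroAtTwo` (stmt-BirchSwinnertonDyer-19098) — T20's typed input in its
# PRINT-EXACT home (pen RC-364 (1) AP4; cell `bsd-cited` ARM-P flag `Kato-1713-dual-action`): the odd-branch package over the
# dual Selmer datum of key `γ⁻¹` (`Kato2004.MultDivisibilityInputsContra`), exceptional prime at Kato's natural `(5T + 4)`,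
# and the door `ℓ_𝔮(X) ≤ ℓ_𝔮(Λ/(L̃))` at EVERY height-one `𝔮 ∌ 2` for that datum (one `@[conjecture]` def + theorems)

Seat `bsd-2adic-addL2x` GEN 16 (sequel of `…AdditiveKatoTransport.lean` p682028 and `…ConventionDefs.lean`). WHY: the landed
input `KatoOddBranchInputsAtTwoNegOneSplitTwist` (and K11b, whose idiom it copies) pairs the covariant `I = 𝐇¹_Γ(T₂W)`
(`T = conj_γ − 1`) with a key-`γ` dual Selmer datum (contragredient `Λ`-structure), which the cell's print register classifies
as «stronger than print by `ι` AS A PACKAGE» — one crossing map of (17.13.1) is then `Λ`-linear only up to an `ι`-symmetry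
(`Literature/…/Kato2004/DivisibilityInputsContragredient.lean`, module docstring). The PRINT-EXACT placement keys the dual
Selmer datum to `γ⁻¹`: then every map of (17.13.1) is `Λ`-linear AS PRINTED (Kato §17.3 «in the natural way», §17.13) and
the local term `𝐇²_loc ≅ ℤ₂(−1)` sits at Kato's natural prime `(γ − κ(γ)⁻¹) = (5T + 4)` (13.13; `κ(γ) = 5`), the Coleman
image being `≐ 2ⁿ·(5T+4)·L⁻` (T20 (b): Perrin-Riou's `𝔏` has colength one there on the odd branch). This file types THAT
input (`KatoOddBranchInputsAtTwoNegOneSplitTwistPrintExact`) and proves the corresponding door for the key-`γ⁻¹` datum by the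
print-exact kernel twins `Kato2004.MultDivisibilityInputsContra.lengthAt_X_le_{off_factor,at_factor_of_transport}`
(`Kato2004/DivisibilityInputsContraExceptionalTransportProofs.lean`, this GEN). The conclusion transfers to the key-`γ` datum
`D = (D')^ι` by `ℓ_𝔮(D.X) = ℓ_{ι𝔮}(D'.X)` (`Kato2004.lengthAt_eq_of_involSemilinear`, once the twist lemma for
`SelmerDualData` is in the tree) and the functional equation — the END statements are `ι`-safe.

HONEST FRAMING (cell `bsd-2adic`, D-0036/D-0054): one typed constant (nothing asserted; conjecture-grade at `2`, print at odd
`p` exactly like `Kato2004.exists_multDivisibilityInputs_split_contra`) + conditional theorems; types-the-object-of; closes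
none; nothing booked; BSD is not proved by any of this.

References: [Kato2004Asterisque] §12.2 (p. 220), Thm. 12.4 (p. 221), Thm. 12.5 (1)–(3) with (12.5.1) (p. 222), 12.6, 13.13
(pp. 233–234), §16.1, 16.2, 16.6 (pp. 268–271), §17.3 (p. 273), §17.13 (pp. 279–280); [Greenberg1989] pp. 101–102;
[Kobayashi2006DocMath] Thm. 4.1 (odd p); [GreenbergLNM1716] Thm. 1.14; [MazurTateTeitelbaum1986Invent] §I.10, §I.13, §I.17.
-/

set_option autoImplicit false
-- the summit's namespace `Summit.BirchSwinnertonDyer.BirchSwinnertonDyer` (Sub = Summit) trips `dupNamespace`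
set_option linter.dupNamespace false

noncomputable section

open scoped Classical MatrixGroups ModularForm

open Field CongruenceSubgroup WeierstrassCurve Literature.NumberTheory.EllipticCurves
  Literature.NumberTheory.EllipticCurves.ModularForms Literature.NumberTheory.EllipticCurves.IwasawaAlgebra
  Literature.NumberTheory.EllipticCurves.Module

namespace Summit.BirchSwinnertonDyer.BirchSwinnertonDyer.Theorems.AddKatoTwo

/-! ## §1 The typed input in its print-exact home -/

/-- [crux input, MEMO — PRINT-EXACT home of T20 (b)] **The ODD-BRANCH §17.13 package at `p = 2` for an additive curve whose
twist by `−1` is split multiplicative at `2`, over the dual Selmer datum of key `γ⁻¹`** (`Kato2004.MultDivisibilityInputsContra`,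
the placement in which (17.13.1) is `Λ`-linear as printed against the covariant `𝐇¹_Γ`). For every globally minimal `W/ℚ` with
`W^{(−1)}` split multiplicative at `2` and `W[2]` irreducible, cyclotomic `κ` with generator `γ`, `κ_cyc(γ) = 5`, every newform `f`
of `W^{(−1)}`, every `I = 𝐇¹_Γ(T₂W)` and every `D' : W.SelmerDualData κ γ⁻¹`: a package for `L = ι(5T+4)·L⁻`,
`L⁻ = padicLFunctionMinusBranchMult f 1 1`, whose Coleman map has cokernel of length `0` at every height-one `𝔮 ∌ 2` and whose
local term (Thm. 12.5 (3); `= ℤ₂(−1)^∨-type = Λ/(γ − κ(γ)⁻¹)` by 13.13, natural action `σ ↦ κ(σ)⁻¹`) has length `0` at every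
height-one `𝔮 ∌ 2` other than `(5T + 4)`. CONTENT = T20 (b) (Kato 12.4/12.5 (1)–(3)/12.6 for `f_W`; (17.13.1) «exact upto ×2»;
13.13; Thm. 16.2/16.6 for `f_{W^{(−1)}}` with `α = 1`, transported to the odd branch; Coleman clause = odd-branch twin of Kobayashi
2006 Thm. 4.1, printed for odd `p` only — conjecture-grade at `2`, exactly like `Kato2004.exists_multDivisibilityInputs_split_contra`
at `p = 2`). [cite: Kato2004Asterisque, Thm. 12.4 (1) (p. 221), Thm. 12.5 (1)–(3) with (12.5.1) (pp. 221–222), Thm. 12.6 (p. 222), 13.13 (pp. 233–234), §16.1 and Thm. 16.2, 16.6 (pp. 268–271), §17.3 (p. 273), §17.13 (pp. 279–280)]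
[cite: Kobayashi2006DocMath, Thm. 4.1 (odd p)] [cite: Greenberg1989, pp. 101–102 (S^ι)] -/
@[conjecture] def KatoOddBranchInputsAtTwoNegOneSplitTwistPrintExact : Prop :=
  ∀ (W : WeierstrassCurve ℚ) [W.IsElliptic] [W.IsGloballyMinimal]
    [ContinuousSMul ℤ_[2] (W.tateModule 2)] {N : ℕ} [NeZero N] (f : CuspForm (Gamma0 N) 2)
    (κ : ZpExtension ℚ 2) (γ : absoluteGaloisGroup ℚ),
    (W.quadraticTwist (-1)).HasSplitMultiplicativeReductionAtPrime 2 → W.HasIrreducibleModPGaloisRep 2 →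
    κ.IsCyclotomic → κ.IsTopGenerator γ → IsCyclotomicVariable 2 γ → IsNewformOf (W.quadraticTwist (-1)) f →
    ∀ (I : Kato2004.IwasawaH1Data W 2 κ γ) (D' : W.SelmerDualData κ γ⁻¹),
      ∃ K : Kato2004.MultDivisibilityInputsContra W 2
          (iwasawaToPowerSeries 2 (PowerSeries.C 5 * PowerSeries.X + PowerSeries.C 4) *
            padicLFunctionMinusBranchMult f (1 : ℚ_[2]) 1) κ γ I D',
        (∀ 𝔮 : PrimeSpectrum (IwasawaAlgebra 2), 𝔮.asIdeal.height = 1 →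
            PowerSeries.C (2 : ℤ_[2]) ∉ 𝔮.asIdeal →
            Module.lengthAt (IwasawaAlgebra 2) (IwasawaAlgebra 2 ⧸ LinearMap.range K.col) 𝔮 = 0) ∧
        (∀ 𝔮 : PrimeSpectrum (IwasawaAlgebra 2), 𝔮.asIdeal.height = 1 →
            PowerSeries.C (2 : ℤ_[2]) ∉ 𝔮.asIdeal →
            𝔮.asIdeal ≠ Ideal.span {(PowerSeries.C 5 * PowerSeries.X + PowerSeries.C 4 : IwasawaAlgebra 2)} →
            Module.lengthAt (IwasawaAlgebra 2) K.H2loc 𝔮 = 0)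

/-! ## §2 The door for the key-`γ⁻¹` datum -/

/-- **`ℓ_𝔮(X') ≤ ℓ_𝔮(Λ/(L̃))` at EVERY height-one `𝔮 ∌ 2` for the key-`γ⁻¹` dual Selmer datum `D'` of `W` (additive at `2`,
`W^{(−1)}` split multiplicative, `W[2]` irreducible)**, from: `Kato2004.thm12_4`, the print-exact input
`KatoOddBranchInputsAtTwoNegOneSplitTwistPrintExact`, finite generation of `D'.X` (hypothesis), the symmetry
`ι(char D'.X) = char D'.X` (T20 (a): Greenberg 1.14 ×2 + twist decomposition; used only at `𝔮 ∋ 5T+4`) and the functional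
equation `(ι L̃) = (L̃)` of an integral multiple `L̃ = 2^m L⁻ ≠ 0`. Off `(5T+4)` the package alone; at it, transport from
`ι(5T+4) ≐ (T−4)` (the kernel decides: `AddKatoTwo.not_mem_comap_invol_of_mem_five_X_add_four`).
[cite: Kato2004Asterisque, Thm. 12.4 (2) (p. 221), Thm. 12.5 (3) and (12.5.1) (p. 222), Conj. 17.6 (p. 274), §17.13 (pp. 279–280)]
[cite: GreenbergLNM1716, Thm. 1.14 (p. 68)] [cite: MazurTateTeitelbaum1986Invent, §I.17] -/
theorem lengthAt_selmerDualContra_le_of_oddBranchInputsPrintExact (h12 : Kato2004.thm12_4)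
    (hPE : KatoOddBranchInputsAtTwoNegOneSplitTwistPrintExact)
    (W : WeierstrassCurve ℚ) [W.IsElliptic] [W.IsGloballyMinimal] [ContinuousSMul ℤ_[2] (W.tateModule 2)]
    {N : ℕ} [NeZero N] (f : CuspForm (Gamma0 N) 2) (κ : ZpExtension ℚ 2) (γ : absoluteGaloisGroup ℚ)
    (hsp : (W.quadraticTwist (-1)).HasSplitMultiplicativeReductionAtPrime 2)
    (hirr : W.HasIrreducibleModPGaloisRep 2) (hκ : κ.IsCyclotomic) (hγ : κ.IsTopGenerator γ)
    (hγ' : IsCyclotomicVariable 2 γ) (hf : IsNewformOf (W.quadraticTwist (-1)) f)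
    (I : Kato2004.IwasawaH1Data W 2 κ γ) (D' : W.SelmerDualData κ γ⁻¹) [Module.Finite (IwasawaAlgebra 2) D'.X]
    (hXι : (charIdeal (IwasawaAlgebra 2) D'.X).map (invol 2).toRingHom = charIdeal (IwasawaAlgebra 2) D'.X)
    (Lt : IwasawaAlgebra 2) (m : ℕ)
    (hLt : iwasawaToPowerSeries 2 Lt =
      PowerSeries.C ((2 : ℚ_[2]) ^ m) * padicLFunctionMinusBranchMult f (1 : ℚ_[2]) 1)
    (hLt0 : Lt ≠ 0) (hLtι : (Ideal.span {Lt}).map (invol 2).toRingHom = Ideal.span {Lt})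
    (𝔮 : PrimeSpectrum (IwasawaAlgebra 2)) (h𝔮 : 𝔮.asIdeal.height = 1)
    (hp𝔮 : PowerSeries.C (2 : ℤ_[2]) ∉ 𝔮.asIdeal) :
    lengthAt (IwasawaAlgebra 2) D'.X 𝔮 ≤
      lengthAt (IwasawaAlgebra 2) (IwasawaAlgebra 2 ⧸ Ideal.span {Lt}) 𝔮 := by
  obtain ⟨K, -, -⟩ := hPE W f κ γ hsp hirr hκ hγ hγ' hf I D'
  have hp2 : ((2 : ℕ) : ℚ_[2]) = (2 : ℚ_[2]) := by norm_num
  have hLt' : iwasawaToPowerSeries 2 Lt =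
      PowerSeries.C (((2 : ℕ) : ℚ_[2]) ^ m) * padicLFunctionMinusBranchMult f (1 : ℚ_[2]) 1 := by
    rw [hp2]; exact hLt
  have hp𝔮' : PowerSeries.C ((2 : ℕ) : ℤ_[2]) ∉ 𝔮.asIdeal := by exact_mod_cast hp𝔮
  rcases not_mem_comap_invol_of_mem_five_X_add_four 𝔮 hp𝔮 with hoff | hat
  · exact K.lengthAt_X_le_off_factor h12 hκ hγ hLt' hLt0 𝔮 h𝔮 hp𝔮' hoff
  · exact K.lengthAt_X_le_at_factor_of_transport h12 hκ hγ hLt' hLt0 𝔮 h𝔮 hp𝔮' hat hXι hLtι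

/-- The LENGTH-form variant at one prime pair: with `ℓ_{𝔮}(D'.X) = ℓ_{ι𝔮}(D'.X)` (e.g. from the decomposition reading by
`lengthAt_selmerDual_symm_of_decomposition`-type bookkeeping) instead of the ideal form; finite generation of `D'.X` not needed.
[cite: Kato2004Asterisque, Thm. 12.5 (3) and (12.5.1) (p. 222), §17.13 (pp. 279–280)] [cite: GreenbergLNM1716, Thm. 1.14 (p. 68)] -/
theorem lengthAt_selmerDualContra_le_of_oddBranchInputsPrintExact_of_lengthAt_symm (h12 : Kato2004.thm12_4)
    (hPE : KatoOddBranchInputsAtTwoNegOneSplitTwistPrintExact)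
    (W : WeierstrassCurve ℚ) [W.IsElliptic] [W.IsGloballyMinimal] [ContinuousSMul ℤ_[2] (W.tateModule 2)]
    {N : ℕ} [NeZero N] (f : CuspForm (Gamma0 N) 2) (κ : ZpExtension ℚ 2) (γ : absoluteGaloisGroup ℚ)
    (hsp : (W.quadraticTwist (-1)).HasSplitMultiplicativeReductionAtPrime 2)
    (hirr : W.HasIrreducibleModPGaloisRep 2) (hκ : κ.IsCyclotomic) (hγ : κ.IsTopGenerator γ)
    (hγ' : IsCyclotomicVariable 2 γ) (hf : IsNewformOf (W.quadraticTwist (-1)) f)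
    (I : Kato2004.IwasawaH1Data W 2 κ γ) (D' : W.SelmerDualData κ γ⁻¹)
    (Lt : IwasawaAlgebra 2) (m : ℕ)
    (hLt : iwasawaToPowerSeries 2 Lt =
      PowerSeries.C ((2 : ℚ_[2]) ^ m) * padicLFunctionMinusBranchMult f (1 : ℚ_[2]) 1)
    (hLt0 : Lt ≠ 0) (hLtι : (Ideal.span {Lt}).map (invol 2).toRingHom = Ideal.span {Lt})
    (𝔮 : PrimeSpectrum (IwasawaAlgebra 2)) (h𝔮 : 𝔮.asIdeal.height = 1)
    (hp𝔮 : PowerSeries.C (2 : ℤ_[2]) ∉ 𝔮.asIdeal)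
    (hXsym : lengthAt (IwasawaAlgebra 2) D'.X 𝔮 =
      lengthAt (IwasawaAlgebra 2) D'.X (PrimeSpectrum.comap (invol 2).toRingHom 𝔮)) :
    lengthAt (IwasawaAlgebra 2) D'.X 𝔮 ≤
      lengthAt (IwasawaAlgebra 2) (IwasawaAlgebra 2 ⧸ Ideal.span {Lt}) 𝔮 := by
  obtain ⟨K, -, -⟩ := hPE W f κ γ hsp hirr hκ hγ hγ' hf I D'
  have hp2 : ((2 : ℕ) : ℚ_[2]) = (2 : ℚ_[2]) := by norm_num
  have hLt' : iwasawaToPowerSeries 2 Lt =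
      PowerSeries.C (((2 : ℕ) : ℚ_[2]) ^ m) * padicLFunctionMinusBranchMult f (1 : ℚ_[2]) 1 := by
    rw [hp2]; exact hLt
  have hp𝔮' : PowerSeries.C ((2 : ℕ) : ℤ_[2]) ∉ 𝔮.asIdeal := by exact_mod_cast hp𝔮
  rcases not_mem_comap_invol_of_mem_five_X_add_four 𝔮 hp𝔮 with hoff | hat
  · exact K.lengthAt_X_le_off_factor h12 hκ hγ hLt' hLt0 𝔮 h𝔮 hp𝔮' hoff
  · exact K.lengthAt_X_le_at_factor_of_lengthAt_symm h12 hκ hγ hLt' hLt0 𝔮 h𝔮 hp𝔮' hat hXsym hLtι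

end Summit.BirchSwinnertonDyer.BirchSwinnertonDyer.Theorems.AddKatoTwo

end
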